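import Mathlib
import Literature.AlgebraicGeometry.Resolution.WeightedResolutionDatum
import Literature.AlgebraicGeometry.Resolution.CobordantBlowupGlobal
import Literature.AlgebraicGeometry.Resolution.Blowups
import Literature.AlgebraicGeometry.Resolution.BlowupPrincipalCharts
import Summits.ResolutionOfSingularities.ResolutionOfSingularities.Theorems.WeightedInvariantDefs
import Summits.ResolutionOfSingularities.ResolutionOfSingularities.Theorems.WeightedInvariantDatumToEmbeddedAtlasDefs
import Summits.ResolutionOfSingularities.ResolutionOfSingularities.Theorems.WeightedInvariantDatumToEmbeddedAtlasLemmas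
import Summits.ResolutionOfSingularities.ResolutionOfSingularities.Theorems.WeightedInvariantDatumToEmbeddedAtlasBridge
import Summits.ResolutionOfSingularities.ResolutionOfSingularities.Theorems.WeightedInvariantDatumToEmbeddedAtlasCharts
import Summits.ResolutionOfSingularities.ResolutionOfSingularities.Theorems.WeightedInvariantDatumToEmbeddedLift
import Summits.ResolutionOfSingularities.ResolutionOfSingularities.Theorems.WeightedInvariantDatumToEmbeddedAtlas
import Summits.ResolutionOfSingularities.ResolutionOfSingularities.Theorems.WeightedInvariantDatumToEmbeddedAtlasAmbientAssembly
import Summits.ResolutionOfSingularities.ResolutionOfSingularities.Theorems.WeightedInvariantDatumToEmbeddedAtlasQuotient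
import HarnessLib

/-!
# The graded atlas of rank `j + 1` on the blow-up downstairs, assembled (crux `DatumToEmbedded`, line `Sketch`)

Topic: `Summits/ResolutionOfSingularities/ResolutionOfSingularities/Theorems`. Line `Sketch` of the
crux `Theses.WeightedInvariant.DatumToEmbedded` (statement `stmt-ResolutionOfSingularities-0572`)
of the summit `Summit.ResolutionOfSingularities.ResolutionOfSingularities`; this file replaces the
three registered stubs `stub_qs_atlas_ambient`, `stub_qs_atlas_quotient`, `stub_qs_atlas` of the
skeleton by ONE unconditional theorem, `gradedAtlas_succ` (registered sub-goal `stub_qs_atlasSucc`).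

Setting (J. Włodarczyk, arXiv:2203.03090, §2.3.3: the torus quotient of the cobordant blow-up
`B₊` is the blow-up of the quotient downstairs). A closed immersion `i : X ⟶ Y` of an integral
`X` into `f : Y → Spec k` smooth separated quasi-compact over a perfect field, a torus-quotient
presentation `q : X ⟶ V` of rank `j` (`𝒜 : GradedAtlas j f i q`, `Theorems/WeightedInvariantDefs`),
the Rees filtration `R'` of the centre `J = D.centre f (ker i)` with its global cobordant blow-up
`π₊ : B₊ = R'.plus ⟶ Y`, the integral strict transform `X' = V(R'.strictTransformPlus (ker i))`
(`i' : X' ⟶ B₊`, `σX : X' ⟶ X`), a Veronese degree `Dg > 0` with the exceptional identity (A1),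
the Veronese generation (A2) and `K·𝒪_{X'} = (t⁻¹)^{Dg}` (A3) for the downstairs centre
`K = ker (V(J_{Dg}|_X) ⟶ V)`, a blow-up `ρ : V' ⟶ V` along `K` (`V'` integral) and
`q' : X' ⟶ V'` over `X ⟶ V`. CONCLUSION: `Nonempty (GradedAtlas (j + 1) (π₊ ≫ f) i' q')`.

The proof is the assembly of `…Theorems.DatumToEmbedded.Atlas.stub_qs_atlas`
(`Theorems/WeightedInvariantDatumToEmbeddedAtlas.lean`) with its two hypotheses DISCHARGED by
the landed theorems `…AtlasAmbient.stub_qs_atlas_ambient` (the ambient chart `D(β t^{Dg})` with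
its contraction property, `Theorems/WeightedInvariantDatumToEmbeddedAtlasAmbientAssembly.lean`)
and `…AtlasQuotient.stub_qs_atlasQuotientOf` (the principal chart downstairs under an ambient
chart, `Theorems/WeightedInvariantDatumToEmbeddedAtlasQuotient.lean` — which needs
`β ∈ J_{Dg}(W a)`, available here because `β` is the degree-`0` lift of a generator of `K(U a)`
INSIDE `J_{Dg}(W a)`, `…AtlasLemmas.exists_degreeZero_lift`): index set
`Σ a, (generators of K(U a))`, charts `U (a, b) = V'[U a, b]`, `W (a, b) = D(β t^{Dg})`,
gradings/constants/homogeneity from the ambient chart, `q'♯ ≅` degree `(0,0)` by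
`…AtlasCharts.exists_lift_chart`/`exists_preimage_chart`, injectivity from the quotient chart,
exponent `e · Dg` with units `π₊♯u · η^{e m}` (`…AtlasCharts.exists_unit_chart`), cover by
`…Atlas.stub_qs_atlasCover`.

All proofs are glue on the tree; no definitions, no named facts.
-/

noncomputable section

open CategoryTheory CategoryTheory.Limits AlgebraicGeometry TopologicalSpace
open Literature.AlgebraicGeometry.Resolution
open Summit.ResolutionOfSingularities.ResolutionOfSingularities.Theses.WeightedInvariant
open Summit.ResolutionOfSingularities.ResolutionOfSingularities.Theorems

set_option linter.dupNamespace false -- mandated namespace `…Theorems.DatumToEmbedded.<Topic>`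
-- `Γ(B₊, W')` versus `presheaf.obj` inside `rw` motives and instance problems on the glued scheme
-- `R'.cobordantBlowup` / `R'.plus` (as in `…DatumToEmbedded.AtlasAmbientChart`):
set_option backward.isDefEq.respectTransparency false

namespace Summit.ResolutionOfSingularities.ResolutionOfSingularities.Theorems.DatumToEmbedded.Atlas

/-- **The graded atlas of rank `j + 1` on the blow-up of the quotient** (registered sub-goal
`stub_qs_atlasSucc` of the crux is the same statement; Włodarczyk §2.3.3 "the quotient of the
cobordant blow-up is the blow-up downstairs", in the graded encoding): with the notation of the
module docstring, `q' : X' ⟶ V'` carries a `GradedAtlas (j + 1) (π₊ ≫ f) i' q'`.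
[cite: Wlodarczyk2022, §2.3.3] -/
theorem gradedAtlas_succ :
    ∀ {p : ℕ} (D : WeightedResolutionDatum p) {k : Type} [Field k] [CharP k p] [PerfectField k]
      {Y X V : Scheme.{0}} (f : Y ⟶ Spec (.of k)) [Smooth f] [IsSeparated f] [QuasiCompact f]
      (i : X ⟶ Y) [IsClosedImmersion i] [IsIntegral X] (q : X ⟶ V) [IsIntegral V]
      (g : V ⟶ Spec (.of k)) [IsSeparated g] [LocallyOfFiniteType g] [QuasiCompact g],
      q ≫ g = i ≫ f →
      ∀ {j : ℕ} (𝒜 : GradedAtlas j f i q), (∃ y : Y, ¬ IsBot (D.inv f i.ker y)) →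
      (∀ (a : 𝒜.ι) (n : ℕ), @Ideal.IsHomogeneous (Fin j → ℤ) (AddSubgroup Γ(Y, 𝒜.W a))
        Γ(Y, 𝒜.W a) _ _ _ (𝒜.piece a) _ _ (𝒜.gradedRing a)
        (((D.centre f i.ker).piece n).ideal (𝒜.W a))) →
      ∀ (R' : ReesFiltration Y), R'.ideal = (D.centre f i.ker).piece →
      ∀ [Smooth (R'.πPlus ≫ f)] [IsSeparated (R'.πPlus ≫ f)] [QuasiCompact (R'.πPlus ≫ f)]
        [IsIntegral (R'.strictTransformPlus i.ker).subscheme]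
        (σX : (R'.strictTransformPlus i.ker).subscheme ⟶ X),
        σX ≫ i = (R'.strictTransformPlus i.ker).subschemeι ≫ R'.πPlus →
      ∀ (Dg : ℕ), 0 < Dg →
      ((D.centre f i.ker).piece Dg).comap R'.πPlus = R'.excPlus ^ Dg →
      (∀ (a : 𝒜.ι) (l : ℕ) (x : Γ(Y, 𝒜.W a)),
          x ∈ ((D.centre f i.ker).piece (Dg * (l + 1))).ideal (𝒜.W a) → x ∈ 𝒜.piece a 0 →
          ∃ y ∈ AddSubgroup.closure
            {z : Γ(Y, 𝒜.W a) | ∃ u v : Γ(Y, 𝒜.W a),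
              u ∈ ((D.centre f i.ker).piece Dg).ideal (𝒜.W a) ∧ u ∈ 𝒜.piece a 0 ∧
              v ∈ ((D.centre f i.ker).piece (Dg * l)).ideal (𝒜.W a) ∧ v ∈ 𝒜.piece a 0 ∧
              z = u * v},
            x - y ∈ i.ker.ideal (𝒜.W a)) →
      (((((D.centre f i.ker).piece Dg).comap i).subschemeι ≫ q).ker).comap (σX ≫ q) =
          (R'.excPlus.comap (R'.strictTransformPlus i.ker).subschemeι) ^ Dg →
      ∀ (V' : Scheme.{0}) (ρ : V' ⟶ V),
        IsBlowup ρ ((((D.centre f i.ker).piece Dg).comap i).subschemeι ≫ q).ker →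
        ∀ [IsIntegral V'] (q' : (R'.strictTransformPlus i.ker).subscheme ⟶ V'),
          q' ≫ ρ = σX ≫ q →
          Nonempty (GradedAtlas (j + 1) (R'.πPlus ≫ f)
            (R'.strictTransformPlus i.ker).subschemeι q') := by
  intro p D k _ _ _ Y X V f _ _ _ i _ _ q _ g _ _ _ hq j 𝒜 hguard hhom R' hR' _ _ _ _ σX hσX
    Dg hDg hexc hA2 hA3 V' ρ hρ _ q' hq'
  -- `q` is quasi-compact (it is so after composition with the separated `g`)
  haveI : QuasiCompact q := by
    haveI : QuasiCompact (q ≫ g) := by rw [hq]; infer_instance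
    exact .of_comp q g
  -- `V` is locally Noetherian (of finite type over the field `k`)
  haveI : IsLocallyNoetherian V := LocallyOfFiniteType.isLocallyNoetherian g
  -- `t⁻¹` is not identically zero on the integral strict transform `X'`
  have hτ := Lift.nonempty_preimage_basicOpen D f i hguard R' hR'
  -- (0) finitely many generators of the downstairs centre `K(U a)` on every chart
  choose s hs using fun a : 𝒜.ι =>
    exists_finset_span_eq (((((D.centre f i.ker).piece Dg).comap i).subschemeι ≫ q).ker) (𝒜.U a)
  have hbK : ∀ ab : (Σ a : 𝒜.ι, ↥(s a)), (ab.2 : Γ(V, 𝒜.U ab.1)) ∈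
      (((((D.centre f i.ker).piece Dg).comap i).subschemeι ≫ q).ker).ideal (𝒜.U ab.1) :=
    fun ab => (hs ab.1).le (Ideal.subset_span (Finset.mem_coe.mpr ab.2.2))
  -- (1) degree-zero lifts `β` of the generators, the ambient charts, the quotient charts
  have hβex : ∀ ab : (Σ a : 𝒜.ι, ↥(s a)), ∃ β : Γ(Y, 𝒜.W ab.1),
      β ∈ ((D.centre f i.ker).piece Dg).ideal (𝒜.W ab.1) ∧ β ∈ 𝒜.piece ab.1 0 ∧
        i.app (𝒜.W ab.1) β = q.appLE (𝒜.U ab.1) (i ⁻¹ᵁ (𝒜.W ab.1)) (𝒜.preimage_eq ab.1).le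
          (ab.2 : Γ(V, 𝒜.U ab.1)) :=
    fun ab => exists_degreeZero_lift 𝒜 (D.centre f i.ker).piece Dg ab.1 (hhom ab.1 Dg) (hbK ab)
  choose β hβJ hβ0 hβ using hβex
  choose 𝒞 h𝒞 using fun ab : (Σ a : 𝒜.ι, ↥(s a)) =>
    AtlasAmbient.stub_qs_atlas_ambient D f i q g hq 𝒜 hguard hhom R' hR' Dg hDg hexc ab.1 (β ab)
      (hβJ ab) (hβ0 ab)
  have hQ := fun ab : (Σ a : 𝒜.ι, ↥(s a)) =>
    AtlasQuotient.stub_qs_atlasQuotientOf D f i q g hq 𝒜 hguard R' hR' σX hσX Dg hDg hexc hA3 V'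
      ρ hρ q' hq' ab.1 (ab.2 : Γ(V, 𝒜.U ab.1)) (hbK ab) (β ab) (hβJ ab) (hβ ab) (𝒞 ab) (h𝒞 ab)
  -- (2)-(5) the atlas
  refine ⟨{
    ι := Σ a : 𝒜.ι, ↥(s a)
    finite_ι := by haveI := 𝒜.finite_ι; infer_instance
    U := fun ab => ⟨blowupChart ρ (((((D.centre f i.ker).piece Dg).comap i).subschemeι ≫ q).ker)
      (𝒜.U ab.1) (ab.2 : Γ(V, 𝒜.U ab.1)), hρ.isAffineOpen_blowupChart (hbK ab)⟩
    iSup_eq_top := stub_qs_atlasCover hρ 𝒜.U 𝒜.iSup_eq_top s hs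
    W := fun ab => (𝒞 ab).W'
    preimage_eq := fun ab => (hQ ab).1
    piece := fun ab => (𝒞 ab).piece
    gradedRing := fun ab => (𝒞 ab).gradedRing
    appLE_mem := fun ab c => (𝒞 ab).const_mem c
    isHomogeneous_ker := fun ab => isHomogeneous_ker_chart (𝒞 ab)
    exists_preimage := fun ab s' hs' =>
      exists_preimage_chart 𝒜 (D.centre f i.ker).piece Dg hσX hτ hq' ab.1 (hβ ab) (𝒞 ab)
        (blowupChart_le_preimage ρ _ (𝒜.U ab.1) _) (hQ ab).1 (hA2 ab.1) (hQ ab).2.2.2.1 s' hs'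
    exists_lift := fun ab c' =>
      exists_lift_chart 𝒜 (D.centre f i.ker).piece Dg hσX hτ hq' ab.1 (hβ ab) (𝒞 ab)
        (blowupChart_le_preimage ρ _ (𝒜.U ab.1) _) (hQ ab).1 (D.centre f i.ker).piece_zero
        (D.centre f i.ker).piece_mul_le (hhom ab.1 Dg) (hQ ab).2.2.1 c'
    appLE_injective := fun ab => appLE_injective_of_eq _ (hQ ab).1 (hQ ab).2.2.2.2
    exponent := 𝒜.exponent * Dg
    exponent_pos := Nat.mul_pos 𝒜.exponent_pos hDg
    exists_unit := ?_ }⟩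
  · -- homogeneous units of all degrees in `(e Dg)·ℤʲ⁺¹` near every point of `X'`
    intro x'
    obtain ⟨a, hxa, hunits⟩ := 𝒜.exists_unit (σX x')
    have hqx : ρ (q' x') ∈ (𝒜.U a : V.Opens) := by
      have e1 : (q' ≫ ρ) x' = ρ (q' x') := Scheme.Hom.comp_apply _ _ _
      rw [← e1, hq', Scheme.Hom.comp_apply]
      change σX x' ∈ q ⁻¹ᵁ (𝒜.U a : V.Opens)
      rw [← 𝒜.preimage_eq a]
      exact hxa
    obtain ⟨b, hb⟩ := exists_mem_blowupChart hρ (𝒜.U a) (s a) (hs a) hqx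
    refine ⟨⟨a, b⟩, ?_, fun χ' => exists_unit_chart hσX (𝒞 ⟨a, b⟩) 𝒜.exponent hunits χ'⟩
    have h : x' ∈ q' ⁻¹ᵁ blowupChart ρ _ (𝒜.U a) (b : Γ(V, 𝒜.U a)) := hb
    rw [← (hQ ⟨a, b⟩).1] at h
    exact h


/-- **Registered sub-goal `stub_qs_atlasSucc`** (= `gradedAtlas_succ`, registered by name on the
crux item so that this file is accepted as a `--supports` helper). [cite: Wlodarczyk2022, §2.3.3] -/
theorem stub_qs_atlasSucc :
    ∀ {p : ℕ} (D : WeightedResolutionDatum p) {k : Type} [Field k] [CharP k p] [PerfectField k]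
      {Y X V : Scheme.{0}} (f : Y ⟶ Spec (.of k)) [Smooth f] [IsSeparated f] [QuasiCompact f]
      (i : X ⟶ Y) [IsClosedImmersion i] [IsIntegral X] (q : X ⟶ V) [IsIntegral V]
      (g : V ⟶ Spec (.of k)) [IsSeparated g] [LocallyOfFiniteType g] [QuasiCompact g],
      q ≫ g = i ≫ f →
      ∀ {j : ℕ} (𝒜 : GradedAtlas j f i q), (∃ y : Y, ¬ IsBot (D.inv f i.ker y)) →
      (∀ (a : 𝒜.ι) (n : ℕ), @Ideal.IsHomogeneous (Fin j → ℤ) (AddSubgroup Γ(Y, 𝒜.W a))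
        Γ(Y, 𝒜.W a) _ _ _ (𝒜.piece a) _ _ (𝒜.gradedRing a)
        (((D.centre f i.ker).piece n).ideal (𝒜.W a))) →
      ∀ (R' : ReesFiltration Y), R'.ideal = (D.centre f i.ker).piece →
      ∀ [Smooth (R'.πPlus ≫ f)] [IsSeparated (R'.πPlus ≫ f)] [QuasiCompact (R'.πPlus ≫ f)]
        [IsIntegral (R'.strictTransformPlus i.ker).subscheme]
        (σX : (R'.strictTransformPlus i.ker).subscheme ⟶ X),
        σX ≫ i = (R'.strictTransformPlus i.ker).subschemeι ≫ R'.πPlus →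
      ∀ (Dg : ℕ), 0 < Dg →
      ((D.centre f i.ker).piece Dg).comap R'.πPlus = R'.excPlus ^ Dg →
      (∀ (a : 𝒜.ι) (l : ℕ) (x : Γ(Y, 𝒜.W a)),
          x ∈ ((D.centre f i.ker).piece (Dg * (l + 1))).ideal (𝒜.W a) → x ∈ 𝒜.piece a 0 →
          ∃ y ∈ AddSubgroup.closure
            {z : Γ(Y, 𝒜.W a) | ∃ u v : Γ(Y, 𝒜.W a),
              u ∈ ((D.centre f i.ker).piece Dg).ideal (𝒜.W a) ∧ u ∈ 𝒜.piece a 0 ∧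
              v ∈ ((D.centre f i.ker).piece (Dg * l)).ideal (𝒜.W a) ∧ v ∈ 𝒜.piece a 0 ∧
              z = u * v},
            x - y ∈ i.ker.ideal (𝒜.W a)) →
      (((((D.centre f i.ker).piece Dg).comap i).subschemeι ≫ q).ker).comap (σX ≫ q) =
          (R'.excPlus.comap (R'.strictTransformPlus i.ker).subschemeι) ^ Dg →
      ∀ (V' : Scheme.{0}) (ρ : V' ⟶ V),
        IsBlowup ρ ((((D.centre f i.ker).piece Dg).comap i).subschemeι ≫ q).ker →
        ∀ [IsIntegral V'] (q' : (R'.strictTransformPlus i.ker).subscheme ⟶ V'),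
          q' ≫ ρ = σX ≫ q →
          Nonempty (GradedAtlas (j + 1) (R'.πPlus ≫ f)
            (R'.strictTransformPlus i.ker).subschemeι q') :=
  gradedAtlas_succ

end Summit.ResolutionOfSingularities.ResolutionOfSingularities.Theorems.DatumToEmbedded.Atlas

end
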